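import Literature.Geometry.Hyperkaehler.KaehlerFormSquareNotInvariant
import Literature.Geometry.Hyperkaehler.HolomorphicVolumeFormQuaternionInvariant
import HarnessLib

/-!
# No power `h^{∧k}`, `1 ≤ k ≤ dim_ℂ − 1`, of a Kähler class is invariant under the isotropy group
# `G_M = SU(2)` of a hyperkähler structure (Verbitsky 1996 §1–§2, every degree `2k`), pointwise

Topic `Literature/Geometry/Hyperkaehler`, namespace `Literature.Geometry.Hyperkaehler` (carrier of
`IsLinearHyperkaehler g₀ J`, `ComplexTorusHyperkaehler.lean`: a complex normed space `E` with `I = i•`, a second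
complex structure `J` anticommuting with `I`, `K = IJ`). Sequel of `KaehlerFormSquareNotInvariant.lean`, which
proves the degree-`2` (§6: `ad J h ≠ 0`) and degree-`4` (§4: `ad J (h ∧ h) ≠ 0`, `dim_ℂ ≥ 3`) cases; this file
does EVERY degree at once: for the wedge powers `h^{∧k} = wedgePow (ofRealForm h) k` (the tree's
`Kaehler.ComplexTorus.wedgePow`, complex-valued constant forms of a complex torus) of an `I`-positive real `2`-form
`h`, **`ad J (h^{∧k}) ≠ 0` for all `1 ≤ k ≤ dim_ℂ E − 1`**. Verbitsky's `ad T` is `adAlt T`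
(`LinearAlgebra/Alternating/DerivationExtension.lean`); "`G_M`-invariant" is `ad I β = 0 ∧ ad J β = 0`
(`IsotropyAlgebraAction.lean`), equivalent to invariance under every unit quaternion
(`IsotropyGroupInvariance.lean`, `forall_compContinuousLinearMap_quaternion_iff`) and, for `ad J` alone, to
invariance under the circle `cos θ + sin θ·J` (`adAlt_eq_zero_of_forall_compContinuousLinearMap_circle_eq_self`).
Written by the literature seat `lit-w-verbitsky` (gen 5) of the cell `pub-hsemireg` (HodgeConjecture venture),
2026-08-23.

## Source, verbatim (M. Verbitsky, *Hyperholomorphic bundles over a hyperkähler manifold*, J. Alg. Geom. 5 (1996)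
633–669 = alg-geom/9307008, arXiv numbering; held corpus text `paper:arxiv-alg-geom_9307008` p0001 L107–L131,
p0002 L36–L50, p0003 L34–L44 and L105–L114)

* §1: "Define `ad I`. Let this operator act as a complex structure operator `I` on the bundle of differential
  1-forms. We extend it on `i`-forms for arbitrary `i` using Leibnitz formula:
  `ad I(α∧β) = ad I(α)∧β + α∧ad I(β)`. […] We can integrate this Lie algebra action to the action of a Lie group
  `SU(2)`."
* Prop. 1.2: "Let `ω` be a differential form over a hyperkähler manifold `M`. The form `ω` is `G_M`-invariant
  if and only if it is of Hodge type `(p,p)` with respect to all induced complex structures on `M`."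
* Lemma 2.1, proof: "Consider the bundle `R ⊂ Λ²(M) ⊗ End(B)` spanned by the Kähler forms `ω_L` […]
  Moreover, no section of `R` is `G_M`-invariant. This is proven by another direct computation."
* After Def. 2.4: "For a hyperholomorphic bundle, its `p`-th Chern class is of type `(p,p)` with respect to
  any of induced complex structures."

The printed statements are the degree-`2` one (no Kähler form `ω_L` is `G_M`-invariant) and the criterion
(Prop. 1.2); the every-degree instance below is the same "direct computation" (Leibniz formula + the degree-`2`
case + hard Lefschetz) and is labelled `[folklore]` where no printed sentence states it.

## What is formalised (theorems only; no definition, no named fact, no `sorry`)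

With `Ω` any complex-valued `2`-covector (real-alternating, `E [⋀^Fin 2]→L[ℝ] ℂ`), `T` any operator, `h` a
real `2`-covector and `h^{∧k} := wedgePow (ofRealForm h) k`:

* §1 `ofRealForm_adAlt` (`ad T` commutes with complexification); `wedge_wedge_swap_two`
  (`(P ∧ A) ∧ B = (P ∧ B) ∧ A` for `2`-forms `A, B`: associativity `WedgeAssoc_holds` + commutativity of
  `2`-forms); **`adAlt_wedgePow_succ`** — the LEIBNIZ FORMULA FOR POWERS:
  `ad T (Ω^{∧(k+1)}) = (k+1) • Ω^{∧k} ∧ ad T Ω`; `wedgePow_wedge_eq_zero_of_le`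
  (`Ω^{∧m} ∧ A = 0 ⟹ Ω^{∧m'} ∧ A = 0` for `m ≤ m'`).
* §2 **`adAlt_wedgePow_ne_zero_of_oneOne_pos`**: for `J² = −1`, `JI = −IJ`, ANY real `2`-form `h` with
  `h(v, Iv) > 0` (`v ≠ 0`) and `1 ≤ k`, `k + 1 ≤ dim_ℂ E`: **`ad J (h^{∧k}) ≠ 0`**. Proof:
  `ad J (h^{∧k}) = k • h^{∧(k−1)} ∧ ad J h` (§1); if it vanished, then (padding the power up to `dim_ℂ E − 2`)
  `h^{∧(dim−2)} ∧ ad J h = 0`, and the tree's pointwise hard Lefschetz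
  `Kaehler.ComplexTorus.eq_zero_of_wedgePow_wedge_eq_zero` (`h` is non-degenerate by positivity) gives
  `ad J h = 0`, i.e. `h(J·, J·) = h`, and then `h(Jv, I Jv) = −h(v, Iv) < 0` contradicts positivity at `Jv`
  (the argument of FILE 1's §6 `adAlt_ne_zero_of_pos`, repeated inline). Variants:
  `eq_zero_of_adAlt_smul_wedgePow_eq_zero` (an `ad J`-trivial complex multiple `c • h^{∧k}` has `c = 0` — the
  shape "an invariant degree-`2k` class proportional to `h^k` vanishes"),
  `not_forall_circle_invariant_wedgePow_of_oneOne_pos` (`h^{∧k}` is moved by the circle `cos θ + sin θ·J`).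
* §4 **`IsLinearHyperkaehler.forall_quaternion_invariant_wedgePow_iff`** (`k ≤ dim_ℂ E`, `h` `I`-positive:
  `h^{∧k}` is `SU(2)`-invariant ⟺ `k = 0 ∨ k = dim_ℂ E`) and `IsLinearHyperkaehler.forall_quaternion_invariant_wedgePow_zero`
  (the constant `1 = h^{∧0}` is invariant).
* §3 on the carrier of `IsLinearHyperkaehler g₀ J`: **`not_su2Trivial_wedgePow_of_oneOne_pos`**
  (`¬ (ad I (h^{∧k}) = 0 ∧ ad J (h^{∧k}) = 0)`), **`not_forall_quaternion_invariant_wedgePow_of_oneOne_pos`**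
  (group level: `h^{∧k}` is not invariant under all unit quaternions `a + bI + cJ + dK`),
  `eq_zero_of_forall_quaternion_invariant_smul_wedgePow`, and the case `h = ω_I = fundamentalForm g₀ I` of the
  hyperkähler metric itself, `adAlt_J_wedgePow_fundamentalForm_opI_ne_zero` /
  `not_forall_quaternion_invariant_wedgePow_fundamentalForm_opI`.

The range `1 ≤ k ≤ dim_ℂ E − 1` is where the proof (Lefschetz on `2`-forms needs `k − 1 ≤ dim_ℂ E − 2`) and
the statement live: `k = 0` is the constant `1` (`ad T 1 = 0`, `adAlt_of_degree_zero`), and in top degree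
`k = dim_ℂ E` every covector is `SU(2)`-invariant (unit quaternions have determinant `1`:
`HolomorphicVolumeFormQuaternionInvariant.lean` §5, `IsLinearHyperkaehler.forall_quaternion_invariant_wedgePow_finrank`);
§4 below assembles the three into ONE statement, **`IsLinearHyperkaehler.forall_quaternion_invariant_wedgePow_iff`**:
for `I`-positive `h` and `k ≤ dim_ℂ E`, the power `h^{∧k}` is invariant under all unit quaternions iff `k = 0` or
`k = dim_ℂ E` — the range statement of the cell's LEMMA TW-h exactly.

SCOPE NOTES (faithfulness). (i) Pointwise linear algebra on one complex vector space with an anticommuting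
second complex structure — no metric is needed for §2 (for §3 the quaternionic Hermitian `g₀` only supplies
`I, J, K` and, in the last two theorems, `h = ω_I`). It is the cohomological statement verbatim only for compact
flat tori (constant forms = cohomology, `SU(2)` acting through constant forms), which is the use the
`pub-hsemireg` cell makes of it: its LEMMA TW-h "for `(I, J, K)` hypercomplex on `ℝ^{4n}` and `h` a real
`2`-form with `h(x, Ix) > 0`, `h^k` is not `SU(2)`-invariant for `1 ≤ k ≤ 2n − 1` (not even invariant under
the circle `cos t + sin t·J`)" — here with `dim_ℂ = 2n` replaced by any `dim_ℂ ≥ k + 1` and without the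
type-`(1,1)` hypothesis (only positivity enters); the identification "de Rham cohomology of a flat torus =
constant forms, equivariantly" is NOT formalised here, nor is Verbitsky's Prop. 1.1 passage from forms to
classes on a general compact hyperkähler manifold. (ii) Signs follow `DerivationExtension.lean`; only
non-vanishing is asserted. (iii) Nothing here concerns sheaves, stability or hyperholomorphic connections: the
file says only which powers of a Kähler class fail Verbitsky's invariance criterion (Prop. 1.2 / the sentence
after Def. 2.4) pointwise.

## References

* [Verbitsky1996Hyperholomorphic] M. Verbitsky, J. Alg. Geom. 5 (1996) 633–669 = alg-geom/9307008 (arXiv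
  numbering), §1 (definition of `ad`, Prop. 1.1, Prop. 1.2); §2 Lemma 2.1 (proof) and the sentence after
  Def. 2.4 (read, held corpus text p0001–p0003).
* [Voisin2002] C. Voisin, *Hodge Theory and Complex Algebraic Geometry I* (2002), Lemma 6.20 (pointwise hard
  Lefschetz; the tree's `Kaehler.ComplexTorus.eq_zero_of_wedgePow_wedge_eq_zero`).
* [Lange2023AbelianVarietiesComplex] H. Lange, *Abelian Varieties over the Complex Numbers* (2023), §7.3.1
  Lemma 7.3.6 (the powers `⋀ᵖE`, the tree's `wedgePow`), §7.3.2 (1) (hard Lefschetz for constant forms).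
* [Warner1983] F. W. Warner, *Foundations of Differentiable Manifolds and Lie Groups* (1983), 2.6 (associativity
  and graded commutativity of `∧`; the tree's `WedgeAssoc_holds` / `WedgeComm_holds`).
-/

noncomputable section

-- `Module ℂ` / `NoZeroSMulDivisors ℂ` instance synthesis on `E [⋀^Fin k]→L[ℝ] ℂ` needs one more level of
-- pending instance problems than the default (as in `Kaehler/ComplexTorusHardLefschetz.lean`).
set_option maxSynthPendingDepth 3

open Complex Function Module Literature.LinearAlgebra.Alternating
open Literature.Geometry.Kaehler.ComplexTorus

namespace Literature.Geometry.Hyperkaehler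

/-! ## §1 Leibniz for wedge powers: `ad T (Ω^{∧(k+1)}) = (k+1) • Ω^{∧k} ∧ ad T Ω` -/

section Leibniz

variable {E : Type*} [NormedAddCommGroup E] [NormedSpace ℂ E]

/-- `ad T` commutes with complexification of a real covector (`(ad T η)_ℂ = ad T (η_ℂ)`; `ad T` acts slotwise and
the inclusion `ℝ ⊂ ℂ` acts on the values). [cite: Verbitsky1996Hyperholomorphic, §1 (definition of ad I)] -/
theorem ofRealForm_adAlt {n : ℕ} (T : E →L[ℝ] E) (η : E [⋀^Fin n]→L[ℝ] ℝ) :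
    ofRealForm (adAlt T η) = adAlt T (ofRealForm η) :=
  compContinuousAlternatingMap_adAlt Complex.ofRealCLM T η

/-- Two complex-valued `2`-covectors commute on the nose: `B ∧ A = A ∧ B` (graded commutativity,
`(−1)^{2·2} = 1`; the tree's `WedgeComm_holds`). [cite: Warner1983, 2.6] -/
private theorem wedge_comm_two_two_complex' (A B : E [⋀^Fin 2]→L[ℝ] ℂ) : B.wedge A = A.wedge B := by
  rw [ContinuousAlternatingMap.WedgeComm_holds ℝ E ℂ A B, finCongr_refl,
    ContinuousAlternatingMap.domDomCongr_refl]
  norm_num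

/-- **`(P ∧ A) ∧ B = (P ∧ B) ∧ A`** for `2`-covectors `A, B` and `P` of any degree: associativity
(`WedgeAssoc_holds`, the same reindexing on both sides) and commutativity of `2`-forms. [cite: Warner1983, 2.6] -/
theorem wedge_wedge_swap_two {m : ℕ} (P : E [⋀^Fin m]→L[ℝ] ℂ) (A B : E [⋀^Fin 2]→L[ℝ] ℂ) :
    (P.wedge A).wedge B = (P.wedge B).wedge A := by
  rw [ContinuousAlternatingMap.WedgeAssoc_holds ℝ E ℂ P A B, wedge_comm_two_two_complex' B A,
    ← ContinuousAlternatingMap.WedgeAssoc_holds ℝ E ℂ P B A]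

/-- **Leibniz formula for wedge powers**: `ad T (Ω^{∧(k+1)}) = (k+1) • Ω^{∧k} ∧ ad T Ω` for every operator `T`
and every complex-valued `2`-covector `Ω` — Verbitsky's definition of `ad` on `i`-forms "using Leibnitz formula
`ad I(α∧β) = ad I(α)∧β + α∧ad I(β)`" (the tree's `adAlt_wedge`), iterated along
`Ω^{∧(k+1)} = Ω^{∧k} ∧ Ω` (`wedgePow_succ`), the `2`-form `ad T Ω` commuting past the factors `Ω`.
[cite: Verbitsky1996Hyperholomorphic, §1 (definition of ad I, "Leibnitz formula")]
[cite: Lange2023AbelianVarietiesComplex, §7.3.1 Lemma 7.3.6] -/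
theorem adAlt_wedgePow_succ (T : E →L[ℝ] E) (Ω : E [⋀^Fin 2]→L[ℝ] ℂ) (k : ℕ) :
    adAlt T (wedgePow Ω (k + 1)) = ((k : ℝ) + 1) • (wedgePow Ω k).wedge (adAlt T Ω) := by
  induction k with
  | zero =>
    rw [wedgePow_succ, adAlt_wedge, wedgePow_zero, adAlt_of_degree_zero,
      ContinuousAlternatingMap.zero_wedge]
    simp only [zero_add, Nat.cast_zero, one_smul]
  | succ k ih =>
    rw [wedgePow_succ Ω (k + 1), adAlt_wedge, ih, ContinuousAlternatingMap.wedge_smul_left,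
      wedge_wedge_swap_two, ← wedgePow_succ]
    simp only [Nat.cast_succ, add_smul, one_smul]

/-- Padding a vanishing Lefschetz product: if `Ω^{∧m} ∧ A = 0` for a `2`-covector `A`, then `Ω^{∧m'} ∧ A = 0`
for every `m' ≥ m` (`Ω^{∧(m+1)} ∧ A = (Ω^{∧m} ∧ A) ∧ Ω` by `wedge_wedge_swap_two`).
[cite: Lange2023AbelianVarietiesComplex, §7.3.1 Lemma 7.3.6] -/
theorem wedgePow_wedge_eq_zero_of_le (Ω A : E [⋀^Fin 2]→L[ℝ] ℂ) {m m' : ℕ} (hmm' : m ≤ m')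
    (h0 : (wedgePow Ω m).wedge A = 0) : (wedgePow Ω m').wedge A = 0 := by
  induction m', hmm' using Nat.le_induction with
  | base => exact h0
  | succ m' _ ih =>
    rw [wedgePow_succ, wedge_wedge_swap_two, ih, ContinuousAlternatingMap.zero_wedge]

/-- Sanity check for the lower end of the range: `Ω^{∧0} = 1` IS `ad T`-trivial (degree `0`).
[cite: Verbitsky1996Hyperholomorphic, §1 (definition of ad I)] -/
theorem adAlt_wedgePow_zero (T : E →L[ℝ] E) (Ω : E [⋀^Fin 2]→L[ℝ] ℂ) : adAlt T (wedgePow Ω 0) = 0 :=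
  adAlt_of_degree_zero T _

end Leibniz

/-! ## §2 `ad J (h^{∧k}) ≠ 0` for every `I`-positive real `2`-form `h` and `1 ≤ k ≤ dim_ℂ E − 1` -/

section AnyPower

variable {E : Type*} [NormedAddCommGroup E] [NormedSpace ℂ E] [FiniteDimensional ℂ E]
  {g₀ : E →L[ℝ] E →L[ℝ] ℝ} {J : E →L[ℝ] E}

/-- **The positivity sub-lemma in every degree, pointwise.** Let `J` be a second complex structure on the
complex vector space `(E, I = i•)` anticommuting with `I` (`J² = −1`, `JI = −IJ`; with `K = IJ` the unit
quaternions in `I, J, K` form Verbitsky's isotropy group `G_M = SU(2)` of any hyperkähler metric inducing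
`I, J`), and let `h` be ANY real `2`-form which is `I`-positive (`h(v, Iv) > 0` for `v ≠ 0`) — e.g. the constant
representative of an arbitrary Kähler class of a flat complex torus `E/Λ`. Then for every `k` with `1 ≤ k` and
`k + 1 ≤ dim_ℂ E`: **`ad J (h^{∧k}) ≠ 0`** — the power `h^{∧k}` (degree `2k`) is not of type `(k,k)` for `J`,
hence (Prop. 1.2) not `G_M`-invariant. Proof: `ad J (h^{∧k}) = k • h^{∧(k−1)} ∧ ad J h` (Leibniz,
`adAlt_wedgePow_succ`); if it vanished then `h^{∧(dim−2)} ∧ ad J h = 0` (`wedgePow_wedge_eq_zero_of_le`,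
`k − 1 ≤ dim − 2`), so hard Lefschetz (`Kaehler.ComplexTorus.eq_zero_of_wedgePow_wedge_eq_zero`; `h` is
non-degenerate) gives `ad J h = 0`, i.e. `h(J·, J·) = h`, and `h(Jv, I Jv) = −h(v, Iv) < 0` contradicts
positivity (as in FILE 1's `adAlt_ne_zero_of_pos`). For `k = 1, 2` this is FILE 1's §6 / §4. [folklore]
[cite: Verbitsky1996Hyperholomorphic, §1 Prop. 1.2 and §2 Lemma 2.1 (proof: "no section of R is G_M-invariant"); sentence after Def. 2.4]
[cite: Voisin2002, Lemma 6.20] -/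
theorem adAlt_wedgePow_ne_zero_of_oneOne_pos (hJJ : ∀ v : E, J (J v) = -v)
    (hJI : ∀ v : E, J (I • v) = -(I • J v)) {h : E [⋀^Fin 2]→L[ℝ] ℝ}
    (hpos : ∀ v : E, v ≠ 0 → 0 < h ![v, I • v]) {k : ℕ} (hk : 1 ≤ k)
    (hkn : k + 1 ≤ finrank ℂ E) :
    adAlt J (wedgePow (ofRealForm h) k) ≠ 0 := by
  obtain ⟨m, rfl⟩ : ∃ m, k = m + 1 := ⟨k - 1, by omega⟩
  intro h0
  rw [adAlt_wedgePow_succ] at h0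
  -- strip the scalar `m + 1`
  have hc : ((m : ℝ) + 1) ≠ 0 := by positivity
  have h1 : (wedgePow (ofRealForm h) m).wedge (adAlt J (ofRealForm h)) = 0 :=
    (smul_eq_zero.mp h0).resolve_left hc
  rw [← ofRealForm_adAlt] at h1
  -- `h` is non-degenerate (positivity at `w = Iv`)
  have hnd : ∀ v : E, v ≠ 0 → ∃ w : E, h ![v, w] ≠ 0 :=
    fun v hv ↦ ⟨I • v, (hpos v hv).ne'⟩
  -- pad the power up to `dim − 2` and apply hard Lefschetz on `2`-forms
  have h2 : (wedgePow (ofRealForm h) (finrank ℂ E - 2)).wedge (ofRealForm (adAlt J h)) = 0 :=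
    wedgePow_wedge_eq_zero_of_le _ _ (by omega) h1
  have hη : ofRealForm (adAlt J h) = 0 :=
    eq_zero_of_wedgePow_wedge_eq_zero hnd (show 2 + (finrank ℂ E - 2) = finrank ℂ E by omega) h2
  have hη' : adAlt J h = 0 := ofRealForm_injective (hη.trans ofRealForm_zero.symm)
  -- the degree-`2` sign contradiction (FILE 1 §6): `h` is `J`-invariant, so `h(Jv, I Jv) = −h(v, Iv) < 0`
  have hJinv : ∀ v w : E, h ![J v, J w] = h ![v, w] :=
    (IsLinearHyperkaehler.adAlt_eq_zero_iff_apply₂_invariant hJJ).mp hη'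
  obtain ⟨v, hv⟩ := (finrank_pos_iff_exists_ne_zero (R := ℂ) (M := E)).mp (by omega)
  have hJv : J v ≠ 0 := fun hz ↦ hv (by simpa [hz] using (hJJ v).symm)
  have e1 := hpos (J v) hJv
  have e2 := hpos v hv
  have e3 : h ![J v, I • J v] = -h ![v, I • v] := by
    have hIJ : I • J v = -J (I • v) := by rw [hJI, neg_neg]
    rw [hIJ, apply₂_neg_right, hJinv]
  linarith

/-- **No non-zero complex multiple of `h^{∧k}` is `ad J`-trivial** (`J² = −1`, `JI = −IJ`, `h` `I`-positive,
`1 ≤ k ≤ dim_ℂ E − 1`): `ad J (c • h^{∧k}) = 0 ⟹ c = 0` — the shape in which the sub-lemma is used ("an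
`SU(2)`-invariant degree-`2k` class proportional to `h^k` vanishes"). [folklore]
[cite: Verbitsky1996Hyperholomorphic, §1 Prop. 1.2 and §2 Lemma 2.1 (proof); sentence after Def. 2.4] -/
theorem eq_zero_of_adAlt_smul_wedgePow_eq_zero (hJJ : ∀ v : E, J (J v) = -v)
    (hJI : ∀ v : E, J (I • v) = -(I • J v)) {h : E [⋀^Fin 2]→L[ℝ] ℝ}
    (hpos : ∀ v : E, v ≠ 0 → 0 < h ![v, I • v]) {k : ℕ} (hk : 1 ≤ k)
    (hkn : k + 1 ≤ finrank ℂ E) {c : ℂ}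
    (hc : adAlt J (c • wedgePow (ofRealForm h) k) = 0) : c = 0 := by
  rw [adAlt_smul_right, smul_eq_zero] at hc
  exact hc.resolve_right (adAlt_wedgePow_ne_zero_of_oneOne_pos hJJ hJI hpos hk hkn)

/-- **`h^{∧k}` is moved by the circle of `J`**: not all `(cos θ + sin θ·J)^*` fix `h^{∧k}` (`1 ≤ k ≤ dim_ℂ E − 1`,
`h` `I`-positive) — the infinitesimal statement `ad J (h^{∧k}) ≠ 0` read through
`adAlt_eq_zero_of_forall_compContinuousLinearMap_circle_eq_self` (differentiate at `θ = 0`). [folklore]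
[cite: Verbitsky1996Hyperholomorphic, §1 (Prop. 1.1: "We can integrate this Lie algebra action to the action of a Lie group")] -/
theorem not_forall_circle_invariant_wedgePow_of_oneOne_pos (hJJ : ∀ v : E, J (J v) = -v)
    (hJI : ∀ v : E, J (I • v) = -(I • J v)) {h : E [⋀^Fin 2]→L[ℝ] ℝ}
    (hpos : ∀ v : E, v ≠ 0 → 0 < h ![v, I • v]) {k : ℕ} (hk : 1 ≤ k)
    (hkn : k + 1 ≤ finrank ℂ E) :
    ¬ ∀ θ : ℝ, (wedgePow (ofRealForm h) k).compContinuousLinearMap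
        (Real.cos θ • ContinuousLinearMap.id ℝ E + Real.sin θ • J) = wedgePow (ofRealForm h) k :=
  fun hθ ↦ adAlt_wedgePow_ne_zero_of_oneOne_pos hJJ hJI hpos hk hkn
    (adAlt_eq_zero_of_forall_compContinuousLinearMap_circle_eq_self hJJ hθ)

/-! ## §3 On the carrier of a linear hyperkähler structure: `h^{∧k}` is not `𝔤_M`-trivial, not `SU(2)`-invariant -/

namespace IsLinearHyperkaehler

/-- **`h^{∧k}` is not `𝔤_M`-trivial** (`¬ (ad I (h^{∧k}) = 0 ∧ ad J (h^{∧k}) = 0)`) for every `I`-positive real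
`2`-form `h` (e.g. a positive `(1,1)`-form = a Kähler class) on the carrier of a linear hyperkähler structure
`(g₀, I, J, K)`, for all `1 ≤ k ≤ dim_ℂ E − 1`. [folklore]
[cite: Verbitsky1996Hyperholomorphic, §1 Prop. 1.2 and §2 Lemma 2.1 (proof)] -/
theorem not_su2Trivial_wedgePow_of_oneOne_pos (hk : IsLinearHyperkaehler g₀ J)
    {h : E [⋀^Fin 2]→L[ℝ] ℝ} (hpos : ∀ v : E, v ≠ 0 → 0 < h ![v, I • v]) {k : ℕ} (h1k : 1 ≤ k)
    (hkn : k + 1 ≤ finrank ℂ E) :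
    ¬ (adAlt (opI E) (wedgePow (ofRealForm h) k) = 0 ∧ adAlt J (wedgePow (ofRealForm h) k) = 0) :=
  fun hIJ ↦ adAlt_wedgePow_ne_zero_of_oneOne_pos hk.J_J hk.J_I hpos h1k hkn hIJ.2

/-- **Group level, every degree: `h^{∧k}` is not invariant under the isotropy group `G_M = SU(2)`** (unit
quaternions `a + bI + cJ + dK` acting diagonally, `β ↦ β(q·, …, q·)`) for every `I`-positive real `2`-form `h`
and all `1 ≤ k ≤ dim_ℂ E − 1` — on a flat complex torus `E/Λ` with any compatible (flat) hyperkähler structure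
this is the sentence "`[h]^k` is not `SU(2)`-invariant for every Kähler class `h` and `1 ≤ k ≤ dim − 1`" at the
level of constant forms (= cohomology of the torus); by `forall_compContinuousLinearMap_quaternion_iff`
(Prop. 1.1/1.2: `SU(2)`-invariant iff `𝔤_M`-trivial). [folklore]
[cite: Verbitsky1996Hyperholomorphic, §1 Prop. 1.1 and Prop. 1.2; §2 Lemma 2.1 (proof); sentence after Def. 2.4] -/
theorem not_forall_quaternion_invariant_wedgePow_of_oneOne_pos (hk : IsLinearHyperkaehler g₀ J)
    {h : E [⋀^Fin 2]→L[ℝ] ℝ} (hpos : ∀ v : E, v ≠ 0 → 0 < h ![v, I • v]) {k : ℕ} (h1k : 1 ≤ k)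
    (hkn : k + 1 ≤ finrank ℂ E) :
    ¬ ∀ a b c d : ℝ, a ^ 2 + b ^ 2 + c ^ 2 + d ^ 2 = 1 →
      (wedgePow (ofRealForm h) k).compContinuousLinearMap
          (a • ContinuousLinearMap.id ℝ E + b • opI E + c • J + d • opK J) =
        wedgePow (ofRealForm h) k :=
  fun hq ↦ hk.not_su2Trivial_wedgePow_of_oneOne_pos hpos h1k hkn
    (hk.forall_compContinuousLinearMap_quaternion_iff.mp hq)

/-- The same in the shape the cell uses: **an `SU(2)`-invariant complex multiple `c • h^{∧k}`
(`1 ≤ k ≤ dim_ℂ E − 1`) is zero.** [folklore]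
[cite: Verbitsky1996Hyperholomorphic, §1 Prop. 1.1 and Prop. 1.2; §2 Lemma 2.1 (proof)] -/
theorem eq_zero_of_forall_quaternion_invariant_smul_wedgePow (hk : IsLinearHyperkaehler g₀ J)
    {h : E [⋀^Fin 2]→L[ℝ] ℝ} (hpos : ∀ v : E, v ≠ 0 → 0 < h ![v, I • v]) {k : ℕ} (h1k : 1 ≤ k)
    (hkn : k + 1 ≤ finrank ℂ E) {c : ℂ}
    (hq : ∀ a b c' d : ℝ, a ^ 2 + b ^ 2 + c' ^ 2 + d ^ 2 = 1 →
      (c • wedgePow (ofRealForm h) k).compContinuousLinearMap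
          (a • ContinuousLinearMap.id ℝ E + b • opI E + c' • J + d • opK J) =
        c • wedgePow (ofRealForm h) k) : c = 0 :=
  eq_zero_of_adAlt_smul_wedgePow_eq_zero hk.J_J hk.J_I hpos h1k hkn
    (hk.forall_compContinuousLinearMap_quaternion_iff.mp hq).2

/-- The Kähler form `ω_I = g₀(I·, ·)` of the hyperkähler metric itself is `I`-positive, so: **no power
`ω_I^{∧k}`, `1 ≤ k ≤ dim_ℂ E − 1`, is `ad J`-trivial** — Lemma 2.1's "no section of `R` is `G_M`-invariant",
one statement for all degrees `2k`. [cite: Verbitsky1996Hyperholomorphic, §2 Lemma 2.1 (proof)]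
[cite: Joyce2007, §10.1.1 eq. (10.1)] -/
theorem adAlt_J_wedgePow_fundamentalForm_opI_ne_zero (hk : IsLinearHyperkaehler g₀ J) {k : ℕ}
    (h1k : 1 ≤ k) (hkn : k + 1 ≤ finrank ℂ E) :
    adAlt J (wedgePow (ofRealForm (fundamentalForm g₀ (opI E))) k) ≠ 0 :=
  adAlt_wedgePow_ne_zero_of_oneOne_pos hk.J_J hk.J_I
    (fun v hv ↦ by rw [hk.fundamentalForm_I_apply, hk.inner_I]; exact hk.pos v hv) h1k hkn

/-- **Group level for the hyperkähler metric's own Kähler form**: `ω_I^{∧k}` is not `SU(2)`-invariant for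
`1 ≤ k ≤ dim_ℂ E − 1`. [cite: Verbitsky1996Hyperholomorphic, §1 Prop. 1.1 and Prop. 1.2; §2 Lemma 2.1 (proof)] -/
theorem not_forall_quaternion_invariant_wedgePow_fundamentalForm_opI (hk : IsLinearHyperkaehler g₀ J)
    {k : ℕ} (h1k : 1 ≤ k) (hkn : k + 1 ≤ finrank ℂ E) :
    ¬ ∀ a b c d : ℝ, a ^ 2 + b ^ 2 + c ^ 2 + d ^ 2 = 1 →
      (wedgePow (ofRealForm (fundamentalForm g₀ (opI E))) k).compContinuousLinearMap
          (a • ContinuousLinearMap.id ℝ E + b • opI E + c • J + d • opK J) =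
        wedgePow (ofRealForm (fundamentalForm g₀ (opI E))) k :=
  hk.not_forall_quaternion_invariant_wedgePow_of_oneOne_pos
    (fun v hv ↦ by rw [hk.fundamentalForm_I_apply, hk.inner_I]; exact hk.pos v hv) h1k hkn

end IsLinearHyperkaehler

end AnyPower

/-! ## §4 The range exactly: `h^{∧k}` is `SU(2)`-invariant iff `k = 0` or `k = dim_ℂ E` -/

section Range

variable {E : Type*} [NormedAddCommGroup E] [NormedSpace ℂ E] [FiniteDimensional ℂ E]
  {g₀ : E →L[ℝ] E →L[ℝ] ℝ} {J : E →L[ℝ] E}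

omit [FiniteDimensional ℂ E] in
/-- The lower end: the constant `0`-form `h^{∧0} = 1` is invariant under every unit quaternion (degree `0`:
`ad I 1 = ad J 1 = 0`). [cite: Verbitsky1996Hyperholomorphic, §1 Prop. 1.1 and Prop. 1.2] -/
theorem IsLinearHyperkaehler.forall_quaternion_invariant_wedgePow_zero (hk : IsLinearHyperkaehler g₀ J)
    (Ω : E [⋀^Fin 2]→L[ℝ] ℂ) {a b c d : ℝ} (habcd : a ^ 2 + b ^ 2 + c ^ 2 + d ^ 2 = 1) :
    (wedgePow Ω 0).compContinuousLinearMap (a • ContinuousLinearMap.id ℝ E + b • opI E + c • J + d • opK J) =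
      wedgePow Ω 0 :=
  hk.forall_compContinuousLinearMap_quaternion_iff.mpr ⟨adAlt_of_degree_zero _ _, adAlt_of_degree_zero _ _⟩
    a b c d habcd

/-- **The range statement of LEMMA TW-h, exactly.** On the carrier of a linear hyperkähler structure
`(g₀, I, J, K)`, for every `I`-positive real `2`-form `h` (e.g. any Kähler class of a flat torus) and every
`k ≤ dim_ℂ E`: the power `h^{∧k}` is invariant under all unit quaternions `a + bI + cJ + dK` **iff `k = 0` or
`k = dim_ℂ E`** — NOT invariant for `1 ≤ k ≤ dim_ℂ E − 1`
(`not_forall_quaternion_invariant_wedgePow_of_oneOne_pos`), invariant in degree `0` (the constant `1`) and in top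
degree `2 dim_ℂ E = dim_ℝ E` (`HolomorphicVolumeFormQuaternionInvariant.lean` §5: unit quaternions have real
determinant `1`). [folklore] [cite: Verbitsky1996Hyperholomorphic, §1 Prop. 1.1 and Prop. 1.2; §2 Lemma 2.1 (proof)] -/
theorem IsLinearHyperkaehler.forall_quaternion_invariant_wedgePow_iff (hk : IsLinearHyperkaehler g₀ J)
    {h : E [⋀^Fin 2]→L[ℝ] ℝ} (hpos : ∀ v : E, v ≠ 0 → 0 < h ![v, I • v]) {k : ℕ} (hkn : k ≤ finrank ℂ E) :
    (∀ a b c d : ℝ, a ^ 2 + b ^ 2 + c ^ 2 + d ^ 2 = 1 →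
      (wedgePow (ofRealForm h) k).compContinuousLinearMap
          (a • ContinuousLinearMap.id ℝ E + b • opI E + c • J + d • opK J) =
        wedgePow (ofRealForm h) k) ↔ k = 0 ∨ k = finrank ℂ E := by
  constructor
  · intro hq
    by_contra hne
    have h0 : k ≠ 0 := fun e ↦ hne (Or.inl e)
    have h1 : k ≠ finrank ℂ E := fun e ↦ hne (Or.inr e)
    exact hk.not_forall_quaternion_invariant_wedgePow_of_oneOne_pos hpos (Nat.one_le_iff_ne_zero.mpr h0)
      (by omega) hq
  · rintro (rfl | rfl) a b c d habcd
    · exact hk.forall_quaternion_invariant_wedgePow_zero _ habcd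
    · exact hk.forall_quaternion_invariant_wedgePow_finrank h habcd

end Range

end Literature.Geometry.Hyperkaehler

end
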